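import Summits.BirchSwinnertonDyer.BirchSwinnertonDyer.Theorems.KolyvaginDepthDoorDepthTableKuriharaDecisivePairBridge
import Summits.BirchSwinnertonDyer.BirchSwinnertonDyer.Theorems.KolyvaginDepthDoorDepthTableGlobalMinimal
import Literature.NumberTheory.EllipticCurves.KuriharaNumberInvariants
import Literature.GroupTheory.FiniteAbelian.NonCyclicSubgroup
import HarnessLib

/-!
# Route `KolyvaginDepthDoor`, crux `KolyvaginDepthSupplyKN` (stmt-BirchSwinnertonDyer-22820) —
# DEPTH TABLE v23, two more CERTIFICATE KITS for the rank-three rows: global minimality from a finite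
# `q¹² ∤ Δ` table (any size of `Δ`), and the cyclicity binder `#Ẽ(𝔽_ℓ)[p] ≤ p` from a GENERATOR of `Ẽ(𝔽_ℓ)`
# (a `decide`-checked addition-chain certificate of its order), for Kolyvagin primes with `p² ∣ #Ẽ(𝔽_ℓ)`

Helper file of the lead prover of line `levelone` (kdd-p1 g27; `--supports stmt-BirchSwinnertonDyer-22820
--as helper`); it closes nothing and BSD is NOT proved by it. Pure kernel plumbing (no named fact).

WHY. Of the `129` depth-three unit records of the tree (`KuriharaCertificates`, `ν = 3`), `28` are certifiable with
the kits of the rank-two table; the two most frequent single blockers of the others are (i) `|Δ| ≥ 3¹²` (the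
small-discriminant criterion `isGloballyMinimal_map_int_of_natAbs_Δ_lt` does not apply) and (ii) `p² ∣ #Ẽ(𝔽_ℓ)` at
one prime of the level (the cyclicity kit `card_torsion_le_of_intModel_of_card` wants `p² ∤ #Ẽ`). Here:
§1 `isGloballyMinimal_map_int_of_table` — Silverman's `Δ`-criterion with a `decide`-able table «`q¹² ∤ |Δ|` for
`q < B`» and `|Δ| < B¹²`; §2 `nonsingular_zmod_of_eval` (an `𝔽_ℓ`-point from its equation, `ℓ ∤ Δ`) and
`card_torsion_le_of_generator` / `card_torsion_le_of_intModel_of_generator` — a point `R ∈ Ẽ(𝔽_ℓ)` with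
`(N/r) • R ≠ O` for every prime `r ∣ N = #Ẽ(𝔽_ℓ)` (chains) has order `N`, so `Ẽ(𝔽_ℓ)` is cyclic and `#Ẽ(𝔽_ℓ)[p] ≤ p`
(Hungerford II §2 Ex. 1). BSD is NOT proved by any of this.

References: [SilvermanAEC2009] VII.1 Rem. 1.1, VIII.8, III.2.3; [Hungerford1974] Ch. II §2 Exercise 1;
[Kim2022StructureSelmer] §1.2.2.
-/

set_option linter.dupNamespace false

noncomputable section

open scoped Classical

namespace Summit.BirchSwinnertonDyer.BirchSwinnertonDyer.Theorems.KolyvaginDepthDoor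

open Literature.NumberTheory.EllipticCurves WeierstrassCurve
open Summit.BirchSwinnertonDyer.BirchSwinnertonDyer.Theorems
open Summit.BirchSwinnertonDyer.BirchSwinnertonDyer.Rank2Observatory

/-! ## §1 Global minimality from a finite `q¹² ∤ Δ` table -/

/-- **Silverman's `Δ`-criterion, table form (unconditional).** An integer Weierstrass equation `W₀` with `Δ ≠ 0`,
`|Δ| < B¹²` and `q¹² ∤ |Δ|` for every prime `q < B` defines a GLOBAL MINIMAL model over `ℚ`: a prime `q ≥ B` has
`q¹² ≥ B¹² > |Δ|`, so no prime has `q¹² ∣ Δ` and `isGloballyMinimal_baseChange_int_of_finrank_mul_lt_twelve` (`k = 11`,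
`[ℚ : ℚ] = 1`) applies. The table is `decide`-able on literals. [cite: SilvermanAEC2009, VII.1 Remark 1.1 and VIII.8] -/
theorem isGloballyMinimal_map_int_of_table (W₀ : WeierstrassCurve ℤ) (h0 : W₀.Δ ≠ 0) (B : ℕ)
    (hB : W₀.Δ.natAbs < B ^ 12) (htab : ∀ q ∈ Finset.range B, q.Prime → ¬ q ^ 12 ∣ W₀.Δ.natAbs) :
    (W₀.map (Int.castRingHom ℚ)).IsGloballyMinimal := by
  have hbc : W₀.map (Int.castRingHom ℚ) = W₀.baseChange ℚ := by
    ext <;> simp [WeierstrassCurve.baseChange, WeierstrassCurve.map]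
  rw [hbc]
  refine isGloballyMinimal_baseChange_int_of_finrank_mul_lt_twelve W₀ ℚ 11 (fun q hq hdvd ↦ ?_)
    (by rw [Module.finrank_self]; norm_num)
  have hpos : 0 < W₀.Δ.natAbs := Int.natAbs_pos.mpr h0
  have h1 : q ^ 12 ∣ W₀.Δ.natAbs := by
    have := Int.natAbs_dvd_natAbs.mpr hdvd
    simpa [Int.natAbs_pow] using this
  rcases Nat.lt_or_ge q B with hqB | hqB
  · exact htab q (Finset.mem_range.mpr hqB) hq h1
  · have hle : q ^ 12 ≤ W₀.Δ.natAbs := Nat.le_of_dvd hpos h1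
    have hBq : B ^ 12 ≤ q ^ 12 := Nat.pow_le_pow_left hqB 12
    omega

/-! ## §2 The cyclicity binder from a generator of `Ẽ(𝔽_ℓ)` -/

section Generator

variable (V : WeierstrassCurve ℤ) (q : ℕ) [Fact q.Prime]

/-- An `𝔽_q`-solution of the Weierstrass equation of `V mod q` (`q ∤ Δ(V)`) is a nonsingular point — the equation as a
`decide`-able ring identity in `ZMod q`. [cite: SilvermanAEC2009, III.1 Prop. 1.4] -/
theorem nonsingular_zmod_of_eval (hq : ¬ (q : ℤ) ∣ V.Δ) {x y : ZMod q}
    (heq : y ^ 2 + (V.a₁ : ZMod q) * x * y + (V.a₃ : ZMod q) * y =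
      x ^ 3 + (V.a₂ : ZMod q) * x ^ 2 + (V.a₄ : ZMod q) * x + (V.a₆ : ZMod q)) :
    (V.map (Int.castRingHom (ZMod q))).toAffine.Nonsingular x y := by
  refine (Affine.equation_iff_nonsingular_of_Δ_ne_zero (Δ_zmod_ne_zero V q hq)).mp ?_
  rw [Affine.equation_iff]
  simpa [WeierstrassCurve.map] using heq

/-- **`Ẽ(𝔽_q)` is cyclic with small `p`-torsion from ONE generator certificate.** `q ∤ Δ(V)`; `#Ẽ(𝔽_q) = N`; an
affine point `R = (x, y)` of `V mod q`; a list of pairs `(r, steps)` covering every prime `r ∣ N` whose chains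
(`Rank2Observatory.chainB`, started at `R`) reach the multiplier `N / r` — so `(N/r) • R ≠ O`. THEN `R` has order `N`
(Lagrange + `addOrderOf_eq_of_nsmul_and_div_prime_nsmul`), `Ẽ(𝔽_q)` is cyclic, and `#{P : p • P = O} ≤ p` for every
`p ≠ 0` (a cyclic group has `|G[p]| = gcd(p, |G|)`). [cite: Hungerford1974, Ch. II §2 Exercise 1] [cite: SilvermanAEC2009, III.2.3] -/
theorem card_torsion_le_of_generator (hq : ¬ (q : ℤ) ∣ V.Δ) {N : ℕ}
    (hc : Nat.card (V.map (Int.castRingHom (ZMod q))).toAffine.Point = N) (hN : 0 < N) {x y : ZMod q}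
    (heq : y ^ 2 + (V.a₁ : ZMod q) * x * y + (V.a₃ : ZMod q) * y =
      x ^ 3 + (V.a₂ : ZMod q) * x ^ 2 + (V.a₄ : ZMod q) * x + (V.a₆ : ZMod q))
    (certs : List (ℕ × List (Bool × ZMod q × ZMod q)))
    (hcov : ∀ r ∈ N.primeFactors, r ∈ certs.map Prod.fst)
    (hchains : ∀ c ∈ certs, chainMult 1 c.2 = N / c.1 ∧ chainB V q x y (x, y) c.2 = true)
    (p : ℕ) (hp : p ≠ 0) :
    Nat.card {P : (V.map (Int.castRingHom (ZMod q))).toAffine.Point // p • P = 0} ≤ p := by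
  set G := (V.map (Int.castRingHom (ZMod q))).toAffine.Point
  haveI : Finite G := Nat.finite_of_card_ne_zero (by rw [hc]; exact hN.ne')
  have hR := nonsingular_zmod_of_eval V q hq heq
  set R : G := Affine.Point.some x y hR with hRdef
  -- `R` has order `N`
  have horder : addOrderOf R = N := by
    refine addOrderOf_eq_of_nsmul_and_div_prime_nsmul hN ?_ (fun r hr hrN ↦ ?_)
    · rw [← hc]; exact card_nsmul_eq_zero'
    · have hmem : r ∈ N.primeFactors := Nat.mem_primeFactors.mpr ⟨hr, hrN, hN.ne'⟩
      obtain ⟨c, hcm, hcr⟩ := List.mem_map.mp (hcov r hmem)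
      obtain ⟨hmult, hchain⟩ := hchains c hcm
      have hne := nsmul_ne_zero_of_chainB V q hR hchain
      rw [hmult, hcr] at hne
      exact hne
  have hcyc : IsAddCyclic G := isAddCyclic_of_addOrderOf_eq_card R (by rw [horder, hc])
  have h := Literature.GroupTheory.FiniteAbelian.natCard_torsionBy_le_of_isAddCyclic G hcyc hp
  refine le_trans (le_of_eq ?_) h
  exact Nat.card_congr (Equiv.subtypeEquivRight fun P ↦ (AddSubgroup.torsionBy.nsmul_iff (x := P)).symm)

/-- **The cyclicity binder of `IsCyclicKolyvaginLevel` READ OFF AN INTEGER MODEL from a generator certificate**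
(`integralModelInt W = E₀`, the shape consumed by `isCyclicKolyvaginLevel_of_three`): as `card_torsion_le_of_generator`
on `E₀`. Replaces `card_torsion_le_of_intModel_of_card` at Kolyvagin primes `ℓ` with `p² ∣ #Ẽ(𝔽_ℓ)` (cyclic `p`-part
of order `p²`). [cite: Kim2022StructureSelmer, §1.2.2] [cite: Hungerford1974, Ch. II §2 Exercise 1] -/
theorem card_torsion_le_of_intModel_of_generator {W : WeierstrassCurve ℚ} [W.IsGloballyMinimal]
    {E₀ : WeierstrassCurve ℤ} (hI : integralModelInt W = E₀) (p : ℕ) [hp : Fact p.Prime]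
    (hq : ¬ (q : ℤ) ∣ E₀.Δ) {N : ℕ} (hc : Nat.card (E₀.map (Int.castRingHom (ZMod q))).toAffine.Point = N)
    (hN : 0 < N) {x y : ZMod q}
    (heq : y ^ 2 + (E₀.a₁ : ZMod q) * x * y + (E₀.a₃ : ZMod q) * y =
      x ^ 3 + (E₀.a₂ : ZMod q) * x ^ 2 + (E₀.a₄ : ZMod q) * x + (E₀.a₆ : ZMod q))
    (certs : List (ℕ × List (Bool × ZMod q × ZMod q)))
    (hcov : ∀ r ∈ N.primeFactors, r ∈ certs.map Prod.fst)
    (hchains : ∀ c ∈ certs, chainMult 1 c.2 = N / c.1 ∧ chainB E₀ q x y (x, y) c.2 = true) :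
    Nat.card {P : ((WeierstrassCurve.integralModelInt W).map
        (Int.castRingHom (ZMod q))).toAffine.Point // p • P = 0} ≤ p := by
  subst hI
  exact card_torsion_le_of_generator _ q hq hc hN heq certs hcov hchains p hp.out.ne_zero

end Generator

end Summit.BirchSwinnertonDyer.BirchSwinnertonDyer.Theorems.KolyvaginDepthDoor

end
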